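import Summits.Ventures.PercRepro.ProfilePointedCircuitClassesStarSharpT

/-!
# PercRepro — THE SERIES-TWIN REGIME OF `StarNineSharp`, III: THE THEOREM (p5, gen 53; `proofs/P5-GM1.md` §80 ADD 4
case C, Sharp layer; continues StarSharpS / StarSharpT)

**`inCount_thru_le_of_seriesTwin`**: on a coloop-free nine-point matroid of rank `5` with a series pair `{b, b′}`, if `f`
has a series twin `z` in `R = N ∖ {b, b′}` (`ρ(E₇ − f − z) = 3`, `ρ(E₇ − f) = ρ(E₇ − z) = 4`) with `z ∉ {e, b, b′}`, then
`in_4(e) + thru_4({b′, f}) + thru_4({b′, e, f}) ≤ in_4(f) + thru_4({e, f}) + thru_4({b′, e})` — the inequality of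
`StarNineSharp` at `(e, f)`.  Proof: by StarSharpS's `inCount_thru_split'` the claim is `#{W ∈ 𝒲 : e ∈ W ∌ f, b′ ∉ W} ≤
#{W ∈ 𝒲 : f ∈ W, b′ ∉ W}`; the demands split into the OFF ones, the ON ones through `z`, and the ON ones inside `H`, and
these are injected by `W ↦ (E ∖ W) − b′`, `W ↦ W − z + f` and the `H`-images of StarSharpT into three DISJOINT families
of targets (avoiding `e` and OFF / containing `e` and `b` / avoiding `e`, containing `b` and ON, or containing `e` and
avoiding `b`).  This is the first regime of the Prop in which the modular cut of `b` is used (the cut lemma); it covers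
34,476 of the 279,552 catalogue configurations (§80).
-/

open scoped Matroid

namespace PercRepro.Cogirth

open Finset ThmH Skew Shadow Profile

variable {α : Type} [DecidableEq α] {N : Matroid α} [N.Finite]

section StarSharpU

variable {b b' : α}

/-- **THE SERIES-TWIN REGIME OF `StarNineSharp`**: on a coloop-free nine-point matroid of rank `5` with a series pair
`{b, b′}`, if `f` has a series twin `z` in `R = N ∖ {b, b′}` (`ρ(E₇ − f − z) = 3`, `ρ(E₇ − f) = ρ(E₇ − z) = 4`) with
`z ∉ {e, b, b′}`, then `in_4(e) + thru_4({b′, f}) + thru_4({b′, e, f}) ≤ in_4(f) + thru_4({e, f}) + thru_4({b′, e})`: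
three disjoint injections of the demands `W ∋ e ∌ f` avoiding `b′` into the sets through `f` avoiding `b′` — the OFF
demands by `W ↦ (E ∖ W) − b′`, the ON demands through `z` by the series swap `W ↦ W − z + f`, the ON demands inside
`H = E₇ − f − z` by `(H − W) + f + b` when that is ON and by `W − b + f` otherwise (the cut lemma). -/
theorem inCount_thru_le_of_seriesTwin (hn : (gr N).card = 9) (hR : rk N (gr N) = 5)
    (hcf : ∀ x ∈ gr N, rk N ((gr N).erase x) = 5) (h : SeriesPair N b b') {e f z : α}
    (hf : f ∈ gr N) (hz : z ∈ gr N) (hef : e ≠ f) (hez : e ≠ z) (hfz : f ≠ z)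
    (heb : e ≠ b) (hfb : f ≠ b) (hfb' : f ≠ b') (hzb : z ≠ b) (hzb' : z ≠ b')
    (hH : rk N (((((gr N).erase b).erase b').erase f).erase z) = 3)
    (hf' : rk N ((((gr N).erase b).erase b').erase f) = 4) (hz' : rk N ((((gr N).erase b).erase b').erase z) = 4) :
    inCount N 4 e + thruCount N 4 {b', f} + thruCount N 4 {b', e, f} ≤
      inCount N 4 f + thruCount N 4 {e, f} + thruCount N 4 {b', e} := by
  rw [inCount_thru_split']
  have hb : b ∈ gr N := h.1
  have hb' : b' ∈ gr N := h.2.1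
  have hbb' : b ≠ b' := h.2.2.1
  -- the demands split by «OFF» (`(E ∖ W) − b′` bi-independent) and, among the ON ones, by `z ∈ W`
  have hsplit1 := card_filter_add_card_filter_not (s := (biIndepSets N 4).filter (fun W => (e ∈ W ∧ f ∉ W) ∧ b' ∉ W))
    (fun W => (gr N \ W).erase b' ∈ biIndepSets N 4)
  have hsplit2 := card_filter_add_card_filter_not (s := (biIndepSets N 4).filter
    (fun W => ((e ∈ W ∧ f ∉ W) ∧ b' ∉ W) ∧ ¬ (gr N \ W).erase b' ∈ biIndepSets N 4)) (fun W => z ∈ W)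
  simp only [filter_filter] at hsplit1 hsplit2
  -- the three target kinds are disjoint sub-families of the targets
  have htar : ((biIndepSets N 4).filter (fun W => (f ∈ W ∧ b' ∉ W) ∧ (e ∉ W ∧ (gr N \ W).erase b' ∈ biIndepSets N 4))).card +
      ((biIndepSets N 4).filter (fun W => (f ∈ W ∧ b' ∉ W) ∧ (e ∈ W ∧ b ∈ W))).card +
      ((biIndepSets N 4).filter (fun W => (f ∈ W ∧ b' ∉ W) ∧
        ((e ∉ W ∧ b ∈ W ∧ ¬ (gr N \ W).erase b' ∈ biIndepSets N 4) ∨ (e ∈ W ∧ b ∉ W)))).card ≤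
      ((biIndepSets N 4).filter (fun W => f ∈ W ∧ b' ∉ W)).card := by
    rw [← card_union_of_disjoint, ← card_union_of_disjoint]
    · apply card_le_card
      intro W hW
      simp only [mem_union, mem_filter] at hW ⊢
      rcases hW with (hW | hW) | hW
      · exact ⟨hW.1, hW.2.1⟩
      · exact ⟨hW.1, hW.2.1⟩
      · exact ⟨hW.1, hW.2.1⟩
    · rw [disjoint_union_left]
      constructor
      · rw [disjoint_filter]
        rintro W _ ⟨-, heW, hcW⟩ ⟨-, h'⟩
        rcases h' with ⟨-, -, hncW⟩ | ⟨heW', -⟩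
        · exact hncW hcW
        · exact heW heW'
      · rw [disjoint_filter]
        rintro W _ ⟨-, heW, hbW⟩ ⟨-, h'⟩
        rcases h' with ⟨hneW, -, -⟩ | ⟨-, hnbW⟩
        · exact hneW heW
        · exact hnbW hbW
    · rw [disjoint_filter]
      rintro W _ ⟨-, heW, -⟩ ⟨-, heW', -⟩
      exact heW heW'
  -- (1) OFF demands → OFF targets avoiding `e`, by the complement
  have hinj1 : ((biIndepSets N 4).filter (fun W => ((e ∈ W ∧ f ∉ W) ∧ b' ∉ W) ∧ (gr N \ W).erase b' ∈ biIndepSets N 4)).card ≤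
      ((biIndepSets N 4).filter (fun W => (f ∈ W ∧ b' ∉ W) ∧ (e ∉ W ∧ (gr N \ W).erase b' ∈ biIndepSets N 4))).card := by
    apply card_le_card_of_injOn (fun W => (gr N \ W).erase b')
    · intro W hW
      simp only [mem_coe, mem_filter] at hW ⊢
      obtain ⟨hWs, ⟨⟨heW, hfW⟩, hb'W⟩, hcW⟩ := hW
      refine ⟨hcW, ⟨mem_erase.2 ⟨hfb', mem_sdiff.2 ⟨hf, hfW⟩⟩, fun h' => (mem_erase.1 h').1 rfl⟩,
        fun h' => (mem_sdiff.1 (mem_of_mem_erase h')).2 heW, ?_⟩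
      rw [compl_erase_erase hWs hb'W]
      exact hWs
    · intro W₁ hW₁ W₂ hW₂ heq
      simp only [mem_coe, mem_filter] at hW₁ hW₂
      have e1 := compl_erase_erase hW₁.1 hW₁.2.1.2
      have e2 := compl_erase_erase hW₂.1 hW₂.2.1.2
      have heq' : (gr N \ W₁).erase b' = (gr N \ W₂).erase b' := heq
      rw [← e1, ← e2, heq']
  -- (2) ON demands through `z` → targets through `e` and `b`, by the series swap
  have hinj2 : ((biIndepSets N 4).filter (fun W => (((e ∈ W ∧ f ∉ W) ∧ b' ∉ W) ∧
        ¬ (gr N \ W).erase b' ∈ biIndepSets N 4) ∧ z ∈ W)).card ≤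
      ((biIndepSets N 4).filter (fun W => (f ∈ W ∧ b' ∉ W) ∧ (e ∈ W ∧ b ∈ W))).card := by
    apply card_le_card_of_injOn (fun W => insert f (W.erase z))
    · intro W hW
      simp only [mem_coe, mem_filter] at hW ⊢
      obtain ⟨hWs, ⟨⟨⟨heW, hfW⟩, hb'W⟩, hcW⟩, hzW⟩ := hW
      have hbW : b ∈ W := by
        by_contra hbW
        exact hcW (compl_erase_mem_of_subset_E7 h hn hWs hbW hb'W)
      refine ⟨swap_mem_of_seriesTwin h hn hf hz hfz hfb hfb' hzb hzb' hH hf' hz' hWs hbW hb'W hzW hfW,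
        ⟨mem_insert_self _ _, fun h' => (mem_insert.1 h').elim (fun h'' => hfb' h''.symm)
          (fun h'' => hb'W (mem_of_mem_erase h''))⟩,
        mem_insert_of_mem (mem_erase.2 ⟨hez, heW⟩), mem_insert_of_mem (mem_erase.2 ⟨hzb.symm, hbW⟩)⟩
    · intro W₁ hW₁ W₂ hW₂ heq
      simp only [mem_coe, mem_filter] at hW₁ hW₂
      have hf₁ : f ∉ W₁.erase z := fun h' => hW₁.2.1.1.1.2 (mem_of_mem_erase h')
      have hf₂ : f ∉ W₂.erase z := fun h' => hW₂.2.1.1.1.2 (mem_of_mem_erase h')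
      have e1 : W₁.erase z = W₂.erase z := by
        have heq' : insert f (W₁.erase z) = insert f (W₂.erase z) := heq
        rw [← erase_insert hf₁, ← erase_insert hf₂, heq']
      rw [← insert_erase hW₁.2.2, ← insert_erase hW₂.2.2, e1]
  -- (3) ON demands inside `H` → the two remaining target kinds, by the `H`-images
  have hHE : ((((gr N).erase b).erase b').erase f).erase z ⊆ ((gr N).erase b).erase b' :=
    (erase_subset _ _).trans (erase_subset _ _)
  have hE7c : (((gr N).erase b).erase b').card = 7 := by
    rw [card_erase_of_mem (mem_erase.2 ⟨hbb'.symm, hb'⟩), card_erase_of_mem hb, hn]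
  -- the data of an ON demand inside `H`
  have hdata : ∀ W ∈ biIndepSets N 4, ((e ∈ W ∧ f ∉ W) ∧ b' ∉ W) → ¬ (gr N \ W).erase b' ∈ biIndepSets N 4 → z ∉ W →
      b ∈ W ∧ W.erase b ⊆ ((((gr N).erase b).erase b').erase f).erase z ∧ (W.erase b).card = 3 ∧
        rk N (insert b (insert b' (W.erase b))) = 4 := by
    intro W hWs hPD hcW hzW
    have hbW : b ∈ W := by
      by_contra hbW
      exact hcW (compl_erase_mem_of_subset_E7 h hn hWs hbW hPD.2)
    obtain ⟨hWg, hW4, -, -⟩ := mem_biIndepSets.1 hWs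
    have hYH : W.erase b ⊆ ((((gr N).erase b).erase b').erase f).erase z := by
      intro x hx
      rw [mem_erase] at hx
      exact mem_erase.2 ⟨fun h' => hzW (h' ▸ hx.2), mem_erase.2 ⟨fun h' => hPD.1.2 (h' ▸ hx.2),
        mem_erase.2 ⟨fun h' => hPD.2 (h' ▸ hx.2), mem_erase.2 ⟨hx.1, hWg hx.2⟩⟩⟩⟩
    have hY3 : (W.erase b).card = 3 := by rw [card_erase_of_mem hbW, hW4]
    have hYE := hYH.trans hHE
    refine ⟨hbW, hYH, hY3, ?_⟩
    have hW' : insert b (W.erase b) ∈ biIndepSets N 4 := by rw [insert_erase hbW]; exact hWs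
    obtain ⟨hYr, hYc⟩ := (insert_b_mem_biIndepSets_iff h hn hYE hY3).1 hW'
    -- `(E ∖ W) − b′ = E₇ ∖ Y`, not bi-independent, so `ρ(Y ∪ {b, b′}) ≠ 5`
    have e1 : (gr N \ W).erase b' = ((gr N).erase b).erase b' \ W.erase b := by
      ext x
      simp only [mem_erase, mem_sdiff, not_and]
      constructor
      · rintro ⟨hxb', hxg, hxW⟩
        exact ⟨⟨hxb', fun h' => hxW (h' ▸ hbW), hxg⟩, fun _ => hxW⟩
      · rintro ⟨⟨hxb', hxb, hxg⟩, hxW⟩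
        exact ⟨hxb', hxg, fun h' => hxW hxb h'⟩
    have hYc' : (((gr N).erase b).erase b' \ W.erase b).card = 4 := by
      rw [card_sdiff_of_subset hYE, hE7c, hY3]
    rw [e1, mem_biIndepSets_iff_of_subset_E7 h hn sdiff_subset hYc', Finset.sdiff_sdiff_eq_self hYE, hYc] at hcW
    have h4 : rk N (insert b (W.erase b)) = 4 := by
      rw [rk_insert_left_eq_add_one_of_seriesPair h hYE, hYr]
    have h5 : rk N (insert b (insert b' (W.erase b))) ≤ rk N (insert b (W.erase b)) + 1 := by
      have e2 : insert b (insert b' (W.erase b)) = insert b' (insert b (W.erase b)) := by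
        ext x; simp only [mem_insert]; tauto
      rw [e2]
      exact rk_insert_le_add_one hb' (insert_subset hb (hYE.trans ((erase_subset _ _).trans (erase_subset _ _))))
    have h6 : rk N (insert b (W.erase b)) ≤ rk N (insert b (insert b' (W.erase b))) :=
      rk_mono' (M := N) (insert_subset_insert b (subset_insert b' _))
    have : ¬ rk N (insert b (insert b' (W.erase b))) = 5 := fun h' => hcW ⟨rfl, h'⟩
    omega
  -- `E₇ ∖ (Y + z) = (H ∖ Y) + f` for `Y ⊆ H`
  have hcomplH : ∀ Y ⊆ ((((gr N).erase b).erase b').erase f).erase z,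
      ((gr N).erase b).erase b' \ insert z Y = insert f (((((gr N).erase b).erase b').erase f).erase z \ Y) := by
    intro Y hY
    ext x
    simp only [mem_sdiff, mem_insert, mem_erase, not_or]
    constructor
    · rintro ⟨⟨hxb', hxb, hxg⟩, hxz, hxY⟩
      by_cases hxf : x = f
      · exact Or.inl hxf
      · exact Or.inr ⟨⟨hxz, hxf, hxb', hxb, hxg⟩, hxY⟩
    · rintro (rfl | ⟨⟨hxz, hxf, hxb', hxb, hxg⟩, hxY⟩)
      · exact ⟨⟨hfb', hfb, hf⟩, hfz, fun h' => (mem_erase.1 (mem_erase.1 (hY h')).2).1 rfl⟩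
      · exact ⟨⟨hxb', hxb, hxg⟩, hxz, hxY⟩
  have hinj3 : ((biIndepSets N 4).filter (fun W => (((e ∈ W ∧ f ∉ W) ∧ b' ∉ W) ∧
        ¬ (gr N \ W).erase b' ∈ biIndepSets N 4) ∧ z ∉ W)).card ≤
      ((biIndepSets N 4).filter (fun W => (f ∈ W ∧ b' ∉ W) ∧
        ((e ∉ W ∧ b ∈ W ∧ ¬ (gr N \ W).erase b' ∈ biIndepSets N 4) ∨ (e ∈ W ∧ b ∉ W)))).card := by
    apply card_le_card_of_injOn (fun W =>
      if rk N (insert b (insert b' (insert f (((((gr N).erase b).erase b').erase f).erase z \ W.erase b)))) = 4 then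
        insert b (insert f (((((gr N).erase b).erase b').erase f).erase z \ W.erase b)) else insert f (W.erase b))
    · intro W hW
      simp only [mem_coe, mem_filter] at hW
      obtain ⟨hWs, ⟨hPD, hcW⟩, hzW⟩ := hW
      obtain ⟨hbW, hYH, hY3, hYon⟩ := hdata W hWs hPD hcW hzW
      have hW' : insert b (W.erase b) ∈ biIndepSets N 4 := by rw [insert_erase hbW]; exact hWs
      obtain ⟨him1, hdisj⟩ := h_images_of_seriesTwin h hn hR hcf hf hz hfz hfb hfb' hzb hzb' hH hf' hz' hYH hY3 hW' hYon
      have hePY : e ∉ ((((gr N).erase b).erase b').erase f).erase z \ W.erase b :=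
        fun h' => (mem_sdiff.1 h').2 (mem_erase.2 ⟨heb, hPD.1.1⟩)
      have hb'P : b' ∉ ((((gr N).erase b).erase b').erase f).erase z \ W.erase b :=
        fun h' => (mem_erase.1 (hHE (mem_sdiff.1 h').1)).1 rfl
      simp only [mem_coe, mem_filter]
      split_ifs with hon
      · refine ⟨him1, ⟨mem_insert_of_mem (mem_insert_self _ _), ?_⟩, Or.inl ⟨?_, mem_insert_self _ _, ?_⟩⟩
        · intro h'
          rcases mem_insert.1 h' with h2 | h2
          · exact hbb' h2.symm
          · rcases mem_insert.1 h2 with h3 | h3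
            · exact hfb' h3.symm
            · exact hb'P h3
        · intro h'
          rcases mem_insert.1 h' with h2 | h2
          · exact heb h2
          · rcases mem_insert.1 h2 with h3 | h3
            · exact hef h3
            · exact hePY h3
        · intro hc
          have hPfE : insert f (((((gr N).erase b).erase b').erase f).erase z \ W.erase b) ⊆ ((gr N).erase b).erase b' :=
            insert_subset (mem_erase.2 ⟨hfb', mem_erase.2 ⟨hfb, hf⟩⟩) (sdiff_subset.trans hHE)
          have e3 : (gr N \ insert b (insert f (((((gr N).erase b).erase b').erase f).erase z \ W.erase b))).erase b' =
              insert z (W.erase b) := by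
            rw [sdiff_insert_b_eq hb' hbb' hPfE, erase_insert (fun h' => (mem_erase.1 (mem_sdiff.1 h').1).1 rfl),
              ← hcomplH (W.erase b) hYH, Finset.sdiff_sdiff_eq_self]
            exact insert_subset (mem_erase.2 ⟨hzb', mem_erase.2 ⟨hzb, hz⟩⟩) (hYH.trans hHE)
          rw [e3] at hc
          have hzYE : insert z (W.erase b) ⊆ ((gr N).erase b).erase b' :=
            insert_subset (mem_erase.2 ⟨hzb', mem_erase.2 ⟨hzb, hz⟩⟩) (hYH.trans hHE)
          have hzY4 : (insert z (W.erase b)).card = 4 := by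
            rw [card_insert_of_notMem (fun h' => (mem_erase.1 (hYH h')).1 rfl), hY3]
          rw [mem_biIndepSets_iff_of_subset_E7 h hn hzYE hzY4, hcomplH (W.erase b) hYH] at hc
          omega
      · rcases hdisj with h4 | him2
        · exact absurd h4 hon
        · refine ⟨him2, ⟨mem_insert_self _ _, ?_⟩, Or.inr ⟨mem_insert_of_mem (mem_erase.2 ⟨heb, hPD.1.1⟩), ?_⟩⟩
          · intro h'
            rcases mem_insert.1 h' with h2 | h2
            · exact hfb' h2.symm
            · exact hPD.2 (mem_of_mem_erase h2)
          · intro h'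
            rcases mem_insert.1 h' with h2 | h2
            · exact hfb h2.symm
            · exact (mem_erase.1 h2).1 rfl
    · intro W₁ hW₁ W₂ hW₂ heq
      simp only [mem_coe, mem_filter] at hW₁ hW₂
      obtain ⟨hb₁, hY₁, -, -⟩ := hdata W₁ hW₁.1 hW₁.2.1.1 hW₁.2.1.2 hW₁.2.2
      obtain ⟨hb₂, hY₂, -, -⟩ := hdata W₂ hW₂.1 hW₂.2.1.1 hW₂.2.1.2 hW₂.2.2
      have hf₁ : f ∉ W₁.erase b := fun h' => (mem_erase.1 (mem_erase.1 (hY₁ h')).2).1 rfl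
      have hf₂ : f ∉ W₂.erase b := fun h' => (mem_erase.1 (mem_erase.1 (hY₂ h')).2).1 rfl
      have hbP : ∀ Y : Finset α, b ∉ insert f (((((gr N).erase b).erase b').erase f).erase z \ Y) := fun Y h' =>
        (mem_insert.1 h').elim (fun h2 => hfb h2.symm)
          (fun h2 => (mem_erase.1 (mem_erase.1 (mem_erase.1 (mem_erase.1 (mem_sdiff.1 h2).1).2).2).2).1 rfl)
      have hbY : ∀ Y : Finset α, b ∉ insert f (Y.erase b) := fun Y h' =>
        (mem_insert.1 h').elim (fun h2 => hfb h2.symm) (fun h2 => (mem_erase.1 h2).1 rfl)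
      simp only at heq
      split_ifs at heq with h₁ h₂ h₂
      · have e1 : ((((gr N).erase b).erase b').erase f).erase z \ W₁.erase b =
            ((((gr N).erase b).erase b').erase f).erase z \ W₂.erase b := by
          have := congrArg (fun S => (S.erase b).erase f) heq
          simp only [erase_insert (hbP _), erase_insert (fun h' => (mem_erase.1 (mem_erase.1 (mem_sdiff.1 h').1).2).1 rfl)] at this
          exact this
        have e2 : W₁.erase b = W₂.erase b := by
          rw [← Finset.sdiff_sdiff_eq_self hY₁, e1, Finset.sdiff_sdiff_eq_self hY₂]
        rw [← insert_erase hb₁, ← insert_erase hb₂, e2]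
      · exact absurd (heq ▸ mem_insert_self b _) (hbY _)
      · exact absurd (heq.symm ▸ mem_insert_self b _) (hbY _)
      · have e2 : W₁.erase b = W₂.erase b := by
          rw [← erase_insert hf₁, ← erase_insert hf₂, heq]
        rw [← insert_erase hb₁, ← insert_erase hb₂, e2]
  omega

end StarSharpU

end PercRepro.Cogirth
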